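import Literature.AnabelianGeometry.Anabelioids.BasicProofs2
import HarnessLib

/-!
# Anabelioids: named facts of `Anabelioids/Basic.lean`, III — relative slimness ⇒ rigidity

Mochizuki, *The geometry of anabelioids*, Publ. RIMS **40** (2004), §1.2, Remark 1.2.9.1, author's
manuscript p. 24 [cite: MochizukiGeoAn2004, Rem. 1.2.9.1 p.24], second assertion: "if `U → V` is
relatively slim, then the arrow `U → V` is rigid [i.e., has no nontrivial automorphisms — cf.
Corollary 1.1.6]."  The statement file `Literature.AnabelianGeometry.Anabelioids.Basic` records
this as the named fact `isRigid_of_isRelativelySlim` (abc-iut cell node `GeoAn:Rmk1.2.9.1`, second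
claim); this proof-only companion discharges it AS TYPED (`isRigid_of_isRelativelySlim_holds`).

Proof (the printed one, "cf. Corollary 1.1.6").  Fix a basepoint `β` of `X` (a fibre functor `F`;
Mathlib's `GaloisCategory.getFiberFunctor`).  By Corollary 1.1.6 — the tree's
`automorphisms_of_arrow_holds` (`BasicProofs2.lean`) —
`Aut(φ) ≃ Z_{π₁(Y, φ ∘ β)}(π₁(φ)(π₁(X, β)))`.
Relative slimness of `π₁(φ)` applied to the open subgroup `π₁(X, β)` itself says that this
centralizer is trivial, so `Aut(φ)` (automorphisms of `φ` in the category `Y ⥤ₑ X` of exact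
functors) is a one-element set; since `Y ⥤ₑ X` is a full subcategory of `Y ⥤ X`, every
automorphism of the functor `φ^*` is an automorphism of `φ`, hence the identity.

Proof-only file: no definitions; nothing of the statement file is restated.  (The third and fourth
assertions of Remark 1.2.9.1, `isSlim_target_of_isRelativelySlim` and
`isSlim_source_of_isRelativelySlim_of_isPi1Mono`, quantify slimness over EVERY basepoint of the
target, resp. source, and are not proved here.)
-/

namespace Literature.AnabelianGeometry.Anabelioids

open CategoryTheory CategoryTheory.Limits CategoryTheory.PreGaloisCategory

universe v₁ v₂ u₁ u₂

/-- **[GeoAn] Remark 1.2.9.1, second assertion** (p. 24): "if `U → V` is relatively slim, then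
the arrow `U → V` is rigid" — the named fact `isRigid_of_isRelativelySlim` HOLDS: for a morphism
of connected anabelioids `φ : X → Y` with `π₁(φ)` relatively slim (for every basepoint of `X`),
the pull-back functor `φ^*` has no nontrivial automorphism.  Via Corollary 1.1.6
(`automorphisms_of_arrow_holds`) at Mathlib's chosen basepoint
`GaloisCategory.getFiberFunctor X`. [cite: MochizukiGeoAn2004, Rem. 1.2.9.1 p.24] -/
theorem isRigid_of_isRelativelySlim_holds : isRigid_of_isRelativelySlim.{v₁, v₂, u₁, u₂} := by
  intro X _ Y _ _ _ φ hslim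
  -- a basepoint of `X` and Corollary 1.1.6 at it
  obtain ⟨e⟩ := automorphisms_of_arrow_holds X Y φ (GaloisCategory.getFiberFunctor X)
  -- relative slimness at the open subgroup `⊤ = π₁(X, β)`: the centralizer of the image is trivial
  have hbot : Subgroup.centralizer
      (Set.range (pi1Map φ.pullback (GaloisCategory.getFiberFunctor X))) = ⊥ := by
    have h := (hslim (GaloisCategory.getFiberFunctor X)).centralizer_eq_bot ⊤
      (by rw [Subgroup.coe_top]; exact isOpen_univ)
    rwa [Subgroup.coe_top, Set.image_univ] at h
  -- hence `Aut(φ)` has at most one element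
  haveI : Subsingleton (φ ≅ φ) := by
    refine ⟨fun a b => e.injective (Subtype.ext ?_)⟩
    have ha : (e a).1 = 1 := Subgroup.mem_bot.mp (hbot.le (e a).2)
    have hb : (e b).1 = 1 := Subgroup.mem_bot.mp (hbot.le (e b).2)
    exact ha.trans hb.symm
  -- an automorphism of the functor `φ^*` is an automorphism of `φ` in `Y ⥤ₑ X`
  intro α
  have h : ((exactFunctor Y X).isoMk α : φ ≅ φ) = Iso.refl φ := Subsingleton.elim _ _
  exact Iso.ext (congrArg (fun β : φ ≅ φ => β.hom.hom) h)

end Literature.AnabelianGeometry.Anabelioids
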